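import Literature.AnabelianGeometry.EtaleTheta.ThetaCoversModelPiC
import HarnessLib

/-!
# [EtTh] Prop. 2.2 (i) at the §1 model: "`ι` acts on `Δ̄_Θ` by `+1`" FOLLOWS from "`ι` acts on `Δ̄^ell_X` by `−1`"
# (profinite class-two group theory; proof-only, GAP-LEDGER G-L2t10-4)

Mochizuki, *The étale theta function …* [EtTh], Publ. RIMS **45** (2009), §2, Rmk. 2.1.1 p. 36 ("`ι` acts on
`Q` by multiplication by `−1`") and Prop. 2.2 (i) p. 37 ("eigenvalues `−1` and `1`, respectively")
[cite: MochizukiEtTh2009, Prop 2.2(i) p.37]. abc-iut cell, seat abc-iut-L6-d6 (gen 3), L2-lead (gen 3) RULINGS #2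
(R23) ROW #4 = GAP-LEDGER G-L2t10-3 + G-L2t10-4 (abc-iut-L2-t10 gen 4, `ThetaCoversModelPiC.lean` names; node
EtTh:Prop2.2 at the model, census P-C4). PROOF-ONLY: no definition, no new named fact; nothing landed is edited.

WHAT THIS FILE DOES. abc-iut-L2-t10's parameter bundle `I : D.PiCData PiC` (the profinite `Π_C ⊇ Π_X` of
`C = X/{±1}`) carries `Δ_X = Π_X ∩ Δ_C` (`I.DeltaX = I.PiX ⊓ I.augGK.ker`), `Ker(Δ_X ↠ Δ̄_X)` (`I.barKer l`, the
closure of `[[Δ_X,Δ_X],Δ_X]·⟨Δ_X^l⟩`) and the `Δ̄_Θ`-preimage (`I.barTheta l`, the closure of `[Δ_X,Δ_X]·⟨Δ_X^l⟩`).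
The constructor of the §2 cover data takes two involution laws as binders (G-L2t10-4):
`hιell : ∀ c ∈ Δ_C ∖ Δ_X, ∀ d ∈ Δ_X, c d c⁻¹ d ∈ barTheta` ("`ι` acts on `Δ̄^ell_X` by `−1`") and
`hιtheta : ∀ c ∈ Δ_C ∖ Δ_X, ∀ t ∈ barTheta, c t c⁻¹ t⁻¹ ∈ barKer` ("`ι` acts on `Δ̄_Θ` by `+1`"). The GAP row
records that the second FOLLOWS from the first "by the commutator pairing `Δ̄_Θ = Im ∧² Δ̄^ell` — derivation not
yet typed". This file types it: in the class-two quotient `Δ_X / barKer` (where `Δ̄_Θ` is central,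
`PiCData.barTheta_central`), an automorphism acting as `x ↦ s_x · x⁻¹` with `s_x` central sends a commutator
`[x₁, x₂]` to `[s₁ x₁⁻¹, s₂ x₂⁻¹] = [x₁⁻¹, x₂⁻¹] = [x₁, x₂]`; closedness of `barKer` and a closure argument pass
from commutators to the whole of `barTheta`. Hence the binder `hιtheta` is DISCHARGED given `hιell` (which stays:
it is a property of the INPUT `Π_C`, census P-C4), for every `c` — the hypotheses `c ∈ Δ_C`, `c ∉ Δ_X` are not
even used.

[EtTh] is refereed; nothing here takes a side on [IUTchIII] Cor. 3.12; typed ≠ proved for the cell's nodes.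
-/

noncomputable section

namespace Literature.AnabelianGeometry.EtaleTheta

open scoped commutatorElement
open _root_.Topology

namespace ThetaSetting

namespace PiCData

variable {p : ℕ} [Fact p.Prime] {D : ThetaSetting p} (l : ℕ)
  {PiC : Type} [Group PiC] [TopologicalSpace PiC] [IsTopologicalGroup PiC] [T2Space PiC]
  (I : D.PiCData PiC)

/-- Class-two bookkeeping: if `s₁, s₂` commute with `x₁, x₂` and with each other, and `[x₁, x₂]` commutes with
`x₁, x₂`, then `[s₁ x₁⁻¹, s₂ x₂⁻¹] = [x₁, x₂]`. [cite: MochizukiEtTh2009, Prop 2.2(i) p.37] -/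
private theorem commutatorElement_central_mul_inv {Q : Type*} [Group Q] {x₁ x₂ s₁ s₂ : Q}
    (h₁₁ : Commute s₁ x₁) (h₁₂ : Commute s₁ x₂) (h₂₁ : Commute s₂ x₁) (h₂₂ : Commute s₂ x₂)
    (hs : Commute s₁ s₂) (hz₁ : Commute ⁅x₁, x₂⁆ x₁) (hz₂ : Commute ⁅x₁, x₂⁆ x₂) :
    ⁅s₁ * x₁⁻¹, s₂ * x₂⁻¹⁆ = ⁅x₁, x₂⁆ := by
  have e₁ : s₁ * (x₁⁻¹ * s₂ * x₂⁻¹ * x₁) * s₁⁻¹ = x₁⁻¹ * s₂ * x₂⁻¹ * x₁ := by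
    have hc : Commute s₁ (x₁⁻¹ * s₂ * x₂⁻¹ * x₁) :=
      ((h₁₁.inv_right.mul_right hs).mul_right h₁₂.inv_right).mul_right h₁₁
    rw [hc.eq, mul_inv_cancel_right]
  have e₂ : s₂ * (x₂⁻¹ * x₁ * x₂) * s₂⁻¹ = x₂⁻¹ * x₁ * x₂ := by
    have hc : Commute s₂ (x₂⁻¹ * x₁ * x₂) := (h₂₂.inv_right.mul_right h₂₁).mul_right h₂₂
    rw [hc.eq, mul_inv_cancel_right]
  have e₃ : x₁ * x₂ = ⁅x₁, x₂⁆ * x₂ * x₁ := by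
    rw [commutatorElement_def]; group
  calc ⁅s₁ * x₁⁻¹, s₂ * x₂⁻¹⁆
      = s₁ * (x₁⁻¹ * s₂ * x₂⁻¹ * x₁) * s₁⁻¹ * (x₂ * s₂⁻¹) := by
        rw [commutatorElement_def]; group
    _ = x₁⁻¹ * (s₂ * (x₂⁻¹ * x₁ * x₂) * s₂⁻¹) := by rw [e₁]; group
    _ = x₁⁻¹ * x₂⁻¹ * (x₁ * x₂) := by rw [e₂]; group
    _ = x₁⁻¹ * (x₂⁻¹ * ⁅x₁, x₂⁆) * x₂ * x₁ := by rw [e₃]; group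
    _ = ⁅x₁, x₂⁆ := by
        rw [← hz₂.inv_right.eq, ← mul_assoc, ← hz₁.inv_right.eq]; group

/-- Class-two bookkeeping, conjugation form: if `u xᵢ u⁻¹ = sᵢ xᵢ⁻¹` with `sᵢ` as above, then `u` centralises
`[x₁, x₂]`. [cite: MochizukiEtTh2009, Prop 2.2(i) p.37] -/
private theorem conj_commutatorElement_mul_inv_eq_one {Q : Type*} [Group Q] {u x₁ x₂ s₁ s₂ : Q}
    (hux₁ : u * x₁ * u⁻¹ = s₁ * x₁⁻¹) (hux₂ : u * x₂ * u⁻¹ = s₂ * x₂⁻¹)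
    (h₁₁ : Commute s₁ x₁) (h₁₂ : Commute s₁ x₂) (h₂₁ : Commute s₂ x₁) (h₂₂ : Commute s₂ x₂)
    (hs : Commute s₁ s₂) (hz₁ : Commute ⁅x₁, x₂⁆ x₁) (hz₂ : Commute ⁅x₁, x₂⁆ x₂) :
    u * ⁅x₁, x₂⁆ * u⁻¹ * ⁅x₁, x₂⁆⁻¹ = 1 := by
  have hconj : u * ⁅x₁, x₂⁆ * u⁻¹ = ⁅u * x₁ * u⁻¹, u * x₂ * u⁻¹⁆ := by
    simp only [commutatorElement_def]; group
  rw [hconj, hux₁, hux₂, commutatorElement_central_mul_inv h₁₁ h₁₂ h₂₁ h₂₂ hs hz₁ hz₂, mul_inv_cancel]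

/-- Elements whose commutator lies in a normal subgroup commute in the quotient.
[cite: MochizukiEtTh2009, Prop 2.2(i) p.37] -/
private theorem commute_mk_of_mem {G : Type*} [Group G] (K : Subgroup G) [K.Normal] {a b : G}
    (h : a * b * a⁻¹ * b⁻¹ ∈ K) : Commute (a : G ⧸ K) (b : G ⧸ K) := by
  have h1 : ((a * b * a⁻¹ * b⁻¹ : G) : G ⧸ K) = 1 := (QuotientGroup.eq_one_iff _).2 h
  rw [QuotientGroup.mk_mul, QuotientGroup.mk_mul, QuotientGroup.mk_mul, QuotientGroup.mk_inv,
    QuotientGroup.mk_inv, ← commutatorElement_def, commutatorElement_eq_one_iff_mul_comm] at h1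
  exact h1

/-- **"`ι` acts on `Δ̄_Θ` by `+1`" FOLLOWS from "`ι` acts on `Δ̄^ell_X` by `−1`"** ([EtTh] Rmk. 2.1.1 / Prop. 2.2 (i)
at the §1 model, pointwise in `c ∈ Π_C`): if `c d c⁻¹ d ∈ barTheta` for every `d ∈ Δ_X = Π_X ∩ Δ_C`, then
`c t c⁻¹ t⁻¹ ∈ barKer` for every `t ∈ barTheta` — conjugation by `c` fixes `Δ̄_Θ = barTheta / barKer` pointwise.
Profinite class-two group theory over abc-iut-L2-t10's `PiCData` lemmas (`barTheta_central`, `barTheta_le`,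
`barKer_normal`, `deltaX_normal`, `isClosed_barKer`); discharges the binder `hιtheta` of GAP-LEDGER G-L2t10-4
given `hιell`. [cite: MochizukiEtTh2009, Prop 2.2(i) p.37] -/
theorem conj_mul_inv_mem_barKer_of_inv_ell (e : D.OncePuncturedData) {c : PiC}
    (hιell : ∀ d ∈ I.PiX ⊓ I.augGK.ker, c * d * c⁻¹ * d ∈ I.barTheta l) :
    ∀ t ∈ I.barTheta l, c * t * c⁻¹ * t⁻¹ ∈ I.barKer l := by
  haveI hK : (I.barKer l).Normal := I.barKer_normal l e
  haveI hΔ : I.DeltaX.Normal := I.deltaX_normal e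
  -- the subgroup `S = {t | c t c⁻¹ t⁻¹ ∈ barKer}` (preimage of the centraliser of `c̄` in `Π_C / barKer`)
  let S : Subgroup PiC :=
    (Subgroup.centralizer {(c : PiC ⧸ I.barKer l)}).comap (QuotientGroup.mk' (I.barKer l))
  have hS : ∀ t, t ∈ S ↔ c * t * c⁻¹ * t⁻¹ ∈ I.barKer l := by
    intro t
    simp only [S, Subgroup.mem_comap, QuotientGroup.mk'_apply, Subgroup.mem_centralizer_iff,
      Set.mem_singleton_iff, forall_eq]
    rw [← QuotientGroup.eq_one_iff, QuotientGroup.mk_mul, QuotientGroup.mk_mul, QuotientGroup.mk_mul,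
      QuotientGroup.mk_inv, QuotientGroup.mk_inv, ← commutatorElement_def,
      commutatorElement_eq_one_iff_mul_comm]
  have hSc : IsClosed (S : Set PiC) := by
    have hset : (S : Set PiC) = (fun t => c * t * c⁻¹ * t⁻¹) ⁻¹' (I.barKer l : Set PiC) := by
      ext t; exact hS t
    rw [hset]
    exact (I.isClosed_barKer l).preimage (by fun_prop)
  -- `barKer ≤ S`
  have hKS : I.barKer l ≤ S := fun t ht =>
    (hS t).2 ((I.barKer l).mul_mem (hK.conj_mem t ht c) ((I.barKer l).inv_mem ht))
  -- the `l`-th powers: `normalClosure Δ_X^l ≤ barKer`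
  have hNK : Subgroup.normalClosure (ClassTwoBar.powSet I.DeltaX l) ≤ I.barKer l := by
    intro x hx
    change x ∈ (⁅⁅I.DeltaX, I.DeltaX⁆, I.DeltaX⁆ ⊔
      Subgroup.normalClosure (ClassTwoBar.powSet I.DeltaX l)).topologicalClosure
    exact Subgroup.le_topologicalClosure _ (Subgroup.mem_sup_right hx)
  -- class two: `[[Δ_X,Δ_X],Δ_X] ≤ barKer`
  have h3K : ⁅⁅I.DeltaX, I.DeltaX⁆, I.DeltaX⁆ ≤ I.barKer l := by
    intro x hx
    change x ∈ (⁅⁅I.DeltaX, I.DeltaX⁆, I.DeltaX⁆ ⊔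
      Subgroup.normalClosure (ClassTwoBar.powSet I.DeltaX l)).topologicalClosure
    exact Subgroup.le_topologicalClosure _ (Subgroup.mem_sup_left hx)
  -- commutators `[d₁, d₂]`, `dᵢ ∈ Δ_X`, lie in `S`: the class-two computation in `Π_C / barKer`
  have hcomm : ⁅I.DeltaX, I.DeltaX⁆ ≤ S := by
    rw [Subgroup.commutator_le]
    intro d₁ hd₁ d₂ hd₂
    have hd₁' : d₁ ∈ I.PiX ⊓ I.augGK.ker := I.deltaX_eq e ▸ hd₁
    have hd₂' : d₂ ∈ I.PiX ⊓ I.augGK.ker := I.deltaX_eq e ▸ hd₂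
    have hT : I.barTheta l ≤ I.PiX ⊓ I.augGK.ker := I.barTheta_le l e
    -- the central correction terms `sᵢ = c dᵢ c⁻¹ dᵢ ∈ barTheta`
    have hs₁ := hιell d₁ hd₁'
    have hs₂ := hιell d₂ hd₂'
    rw [hS, ← QuotientGroup.eq_one_iff]
    -- pass to the class-two quotient `Π_C / barKer`
    have hmk : ((c * ⁅d₁, d₂⁆ * c⁻¹ * ⁅d₁, d₂⁆⁻¹ : PiC) : PiC ⧸ I.barKer l) =
        (c : PiC ⧸ I.barKer l) * ⁅(d₁ : PiC ⧸ I.barKer l), (d₂ : PiC ⧸ I.barKer l)⁆ *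
          (c : PiC ⧸ I.barKer l)⁻¹ * ⁅(d₁ : PiC ⧸ I.barKer l), (d₂ : PiC ⧸ I.barKer l)⁆⁻¹ := by
      simp only [commutatorElement_def, QuotientGroup.mk_mul, QuotientGroup.mk_inv]
    have hzc : ((⁅d₁, d₂⁆ : PiC) : PiC ⧸ I.barKer l) = ⁅(d₁ : PiC ⧸ I.barKer l), (d₂ : PiC ⧸ I.barKer l)⁆ := by
      simp only [commutatorElement_def, QuotientGroup.mk_mul, QuotientGroup.mk_inv]
    have hux₁ : (c : PiC ⧸ I.barKer l) * (d₁ : PiC ⧸ I.barKer l) * (c : PiC ⧸ I.barKer l)⁻¹ =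
        ((c * d₁ * c⁻¹ * d₁ : PiC) : PiC ⧸ I.barKer l) * (d₁ : PiC ⧸ I.barKer l)⁻¹ := by
      simp only [QuotientGroup.mk_mul, QuotientGroup.mk_inv]; group
    have hux₂ : (c : PiC ⧸ I.barKer l) * (d₂ : PiC ⧸ I.barKer l) * (c : PiC ⧸ I.barKer l)⁻¹ =
        ((c * d₂ * c⁻¹ * d₂ : PiC) : PiC ⧸ I.barKer l) * (d₂ : PiC ⧸ I.barKer l)⁻¹ := by
      simp only [QuotientGroup.mk_mul, QuotientGroup.mk_inv]; group
    have h₁₁ := commute_mk_of_mem (I.barKer l) (I.barTheta_central l e _ hs₁ _ hd₁')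
    have h₁₂ := commute_mk_of_mem (I.barKer l) (I.barTheta_central l e _ hs₁ _ hd₂')
    have h₂₁ := commute_mk_of_mem (I.barKer l) (I.barTheta_central l e _ hs₂ _ hd₁')
    have h₂₂ := commute_mk_of_mem (I.barKer l) (I.barTheta_central l e _ hs₂ _ hd₂')
    have hs := commute_mk_of_mem (I.barKer l) (I.barTheta_central l e _ hs₁ _ (hT hs₂))
    have hz₁ : Commute ⁅(d₁ : PiC ⧸ I.barKer l), (d₂ : PiC ⧸ I.barKer l)⁆ (d₁ : PiC ⧸ I.barKer l) := by
      rw [← hzc]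
      refine commute_mk_of_mem (I.barKer l) (h3K ?_)
      rw [← commutatorElement_def]
      exact Subgroup.commutator_mem_commutator (Subgroup.commutator_mem_commutator hd₁ hd₂) hd₁
    have hz₂ : Commute ⁅(d₁ : PiC ⧸ I.barKer l), (d₂ : PiC ⧸ I.barKer l)⁆ (d₂ : PiC ⧸ I.barKer l) := by
      rw [← hzc]
      refine commute_mk_of_mem (I.barKer l) (h3K ?_)
      rw [← commutatorElement_def]
      exact Subgroup.commutator_mem_commutator (Subgroup.commutator_mem_commutator hd₁ hd₂) hd₂
    rw [hmk]
    exact conj_commutatorElement_mul_inv_eq_one hux₁ hux₂ h₁₁ h₁₂ h₂₁ h₂₂ hs hz₁ hz₂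
  -- `barTheta = closure([Δ_X,Δ_X] · normalClosure Δ_X^l) ≤ S` since `S` is closed
  have hTS : I.barTheta l ≤ S := by
    intro t ht
    change t ∈ (⁅I.DeltaX, I.DeltaX⁆ ⊔
      Subgroup.normalClosure (ClassTwoBar.powSet I.DeltaX l)).topologicalClosure at ht
    exact Subgroup.topologicalClosure_minimal _ (sup_le hcomm (hNK.trans hKS)) hSc ht
  exact fun t ht => (hS t).1 (hTS ht)

/-- **The binder `hιtheta` of G-L2t10-4 DISCHARGED given `hιell`** (binder shapes verbatim, abc-iut-L2-t10's
`PiCData.coverDataAx`): if every `c ∈ Δ_C ∖ Δ_X` satisfies `c d c⁻¹ d ∈ barTheta` for all `d ∈ Δ_X` ("`ι` acts on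
`Δ̄^ell_X` by `−1`", [EtTh] Rmk. 2.1.1), then every such `c` satisfies `c t c⁻¹ t⁻¹ ∈ barKer` for all `t ∈ barTheta`
("`ι` acts on `Δ̄_Θ` by `+1`", Prop. 2.2 (i): "eigenvalues `−1` and `1`, respectively").
[cite: MochizukiEtTh2009, Prop 2.2(i) p.37] -/
theorem inv_theta_of_inv_ell (e : D.OncePuncturedData)
    (hιell : ∀ c ∈ I.augGK.ker, c ∉ I.PiX → ∀ d ∈ I.PiX ⊓ I.augGK.ker, c * d * c⁻¹ * d ∈ I.barTheta l) :
    ∀ c ∈ I.augGK.ker, c ∉ I.PiX → ∀ t ∈ I.barTheta l, c * t * c⁻¹ * t⁻¹ ∈ I.barKer l :=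
  fun c hc hcX => I.conj_mul_inv_mem_barKer_of_inv_ell l e (hιell c hc hcX)

end PiCData

end ThetaSetting

end Literature.AnabelianGeometry.EtaleTheta

end
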